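import Summits.Ventures.HodgeRepro2.T5SU11HyperbolicSubgroup
import Summits.Ventures.HodgeRepro2.T5SU11UnipotentSubgroup

/-!
# The Borel subgroup `B = A N` of `SU(1,1)`: `a_t n_s a_t⁻¹ = n_{e^{2t} s}`, a closed non-compact subgroup

The hyperbolic subgroup `A = {a_t}` normalises the unipotent subgroup `N = {n_s}`:
`a_t n_s a_t⁻¹ = n_{e^{2t} s}` (`hyp_mul_unip_mul_hyp_inv`, the matrix identity
`(cosh t + sinh t)² = e^{2t}`). Hence the products `a_t n_s` form a subgroup, the BOREL subgroup
`borelSubgroup = A N` of `SU(1,1)` (`mul_mem`: `a_t n_s a_{t'} n_{s'} = a_{t+t'} n_{e^{-2t'} s + s'}`;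
`inv_mem`: `(a_t n_s)⁻¹ = a_{-t} n_{-e^{2t} s}`), which contains `A` and `N` and, by the Iwasawa
decomposition of `T5SU11Iwasawa`, satisfies `SU(1,1) = K · B`. The parametrisation
`(t, s) ↦ a_t n_s` is PROPER (`|a(a_t n_s)|² = cosh² t + s² e^{2t}`, `tendsto_borel_cocompact`), so `B`
is CLOSED (`isClosed_borelSubgroup`) and NOT compact (`noncompactSpace_borelSubgroup`) — a third
closed non-compact subgroup for the Howe–Moore statements of `T5BergmanNoInvariantVector`. Nothing is
claimed about (N).

Blind lane: Mathlib + the HodgeRepro2 prefix only; no sorry; axioms ⊆ {propext, Classical.choice,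
Quot.sound}.
-/

namespace Summit.Ventures.HodgeRepro2.T5SU11BorelSubgroup

open Metric Filter Topology Set Complex
open T5UnitaryBound T5PoincareDensity T5PoincareInvariance T5SU11Unimodular T5SU11Fibration
  T5SU11Cartan T5SU11OneParameter T5BergmanCoefficient T5BergmanLadder T5SU11HyperbolicSubgroup
  T5SU11UnipotentSubgroup

/-! ### `A` normalises `N` -/

/-- `(cosh t + sinh t)² = e^{2t}`. -/
lemma cosh_add_sinh_sq (t : ℝ) : (Real.cosh t + Real.sinh t) ^ 2 = Real.exp (2 * t) := by
  rw [Real.cosh_add_sinh, ← Real.exp_nat_mul]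
  push_cast
  ring_nf

/-- **`a_t n_s a_t⁻¹ = n_{e^{2t} s}`**: the hyperbolic subgroup normalises the unipotent subgroup,
acting on its parameter by `e^{2t}`. -/
theorem hyp_mul_unip_mul_hyp_inv (t s : ℝ) :
    hyp t * unip s * (hyp t)⁻¹ = unip (Real.exp (2 * t) * s) := by
  apply ext_mat
  rw [mat_mul, mat_mul, mat_hyp, mat_unip, mat_hyp_inv, mat_unip, su11_mul, su11_mul]
  simp only [map_neg, map_mul, map_add, map_one, Complex.conj_ofReal, Complex.conj_I]
  have h1 : ((Real.cosh t : ℂ)) ^ 2 - ((Real.sinh t : ℂ)) ^ 2 = 1 := by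
    exact_mod_cast Real.cosh_sq_sub_sinh_sq t
  have h2 : ((Real.cosh t : ℂ) + (Real.sinh t : ℂ)) ^ 2 = (Real.exp (2 * t) : ℂ) := by
    exact_mod_cast cosh_add_sinh_sq t
  simp only [Complex.ofReal_mul]
  congr 1
  · linear_combination h1 + (I * (s : ℂ)) * h2
  · linear_combination (-(I * (s : ℂ))) * h2

/-- `a_t⁻¹ n_s a_t = n_{e^{-2t} s}`. -/
theorem hyp_inv_mul_unip_mul_hyp (t s : ℝ) :
    (hyp t)⁻¹ * unip s * hyp t = unip (Real.exp (-(2 * t)) * s) := by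
  have h := hyp_mul_unip_mul_hyp_inv (-t) s
  rw [hyp_neg, inv_inv, mul_neg] at h
  exact h

/-- `n_s a_t = a_t n_{e^{-2t} s}`. -/
theorem unip_mul_hyp (s t : ℝ) : unip s * hyp t = hyp t * unip (Real.exp (-(2 * t)) * s) := by
  rw [← hyp_inv_mul_unip_mul_hyp, ← mul_assoc, ← mul_assoc, mul_inv_cancel, one_mul]

/-- `a_t n_s = n_{e^{2t} s} a_t`. -/
theorem hyp_mul_unip (t s : ℝ) : hyp t * unip s = unip (Real.exp (2 * t) * s) * hyp t := by
  rw [← hyp_mul_unip_mul_hyp_inv, inv_mul_cancel_right]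

/-! ### The Borel subgroup `B = A N` -/

/-- **The Borel subgroup** `B = A N = {a_t n_s : t, s ∈ ℝ} ≤ SU(1,1)`. -/
def borelSubgroup : Subgroup SU11 where
  carrier := {g | ∃ t s : ℝ, g = hyp t * unip s}
  mul_mem' := by
    rintro _ _ ⟨t, s, rfl⟩ ⟨t', s', rfl⟩
    refine ⟨t + t', Real.exp (-(2 * t')) * s + s', ?_⟩
    rw [hyp_add, unip_add]
    simp only [mul_assoc]
    rw [← mul_assoc (unip s), unip_mul_hyp s t', mul_assoc]
  one_mem' := ⟨0, 0, by rw [hyp_zero, unip_zero, one_mul]⟩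
  inv_mem' := by
    rintro _ ⟨t, s, rfl⟩
    refine ⟨-t, -(Real.exp (2 * t) * s), ?_⟩
    rw [mul_inv_rev, ← unip_neg, ← hyp_neg, unip_mul_hyp, show -(2 * -t) = 2 * t by ring, mul_neg]

/-- `g ∈ B` iff `g = a_t n_s` for some `t, s`. -/
lemma mem_borelSubgroup_iff (g : SU11) : g ∈ borelSubgroup ↔ ∃ t s : ℝ, g = hyp t * unip s :=
  Iff.rfl

/-- `a_t n_s ∈ B`. -/
lemma hyp_mul_unip_mem_borelSubgroup (t s : ℝ) : hyp t * unip s ∈ borelSubgroup := ⟨t, s, rfl⟩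

/-- `A ≤ B`. -/
theorem hypSubgroup_le_borelSubgroup : hypSubgroup ≤ borelSubgroup := by
  rintro _ ⟨t, rfl⟩
  exact ⟨t, 0, by rw [unip_zero, mul_one]⟩

/-- `N ≤ B`. -/
theorem unipSubgroup_le_borelSubgroup : unipSubgroup ≤ borelSubgroup := by
  rintro _ ⟨s, rfl⟩
  exact ⟨0, s, by rw [hyp_zero, one_mul]⟩

/-- `B = A ⊔ N`. -/
theorem borelSubgroup_eq_sup : borelSubgroup = hypSubgroup ⊔ unipSubgroup := by
  apply le_antisymm
  · rintro _ ⟨t, s, rfl⟩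
    exact Subgroup.mul_mem_sup (hyp_mem_hypSubgroup t) (unip_mem_unipSubgroup s)
  · exact sup_le hypSubgroup_le_borelSubgroup unipSubgroup_le_borelSubgroup

/-- `N` is normal in `B` (as a subgroup of `B`): `b n b⁻¹ ∈ N` for `b ∈ B`, `n ∈ N`. -/
theorem unip_mem_of_mem_borelSubgroup {b : SU11} (hb : b ∈ borelSubgroup) {n : SU11}
    (hn : n ∈ unipSubgroup) : b * n * b⁻¹ ∈ unipSubgroup := by
  obtain ⟨t, s, rfl⟩ := hb
  obtain ⟨r, rfl⟩ := hn
  refine ⟨Real.exp (2 * t) * r, ?_⟩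
  rw [← hyp_mul_unip_mul_hyp_inv, mul_inv_rev, ← unip_neg]
  symm
  calc hyp t * unip s * unip r * (unip (-s) * (hyp t)⁻¹)
      = hyp t * (unip s * unip r * unip (-s)) * (hyp t)⁻¹ := by simp only [mul_assoc]
    _ = hyp t * unip r * (hyp t)⁻¹ := by
        rw [← unip_add, ← unip_add, show s + r + -s = r by ring]

/-! ### `B` is closed and not compact -/

/-- `a(a_t n_s) = cosh t + i s (cosh t + sinh t)`. -/
lemma mat_hyp_mul_unip_zero_zero (t s : ℝ) :
    mat (hyp t * unip s) 0 0 =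
      (Real.cosh t : ℂ) + (s : ℂ) * I * ((Real.cosh t : ℂ) + (Real.sinh t : ℂ)) := by
  rw [mat_mul, mat_hyp, mat_unip, su11_mul]
  simp only [map_neg, map_mul, Complex.conj_ofReal, Complex.conj_I]
  show (Real.cosh t : ℂ) * (1 + (s : ℂ) * I) + (Real.sinh t : ℂ) * -((s : ℂ) * -I) = _
  ring

/-- `|a(a_t n_s)|² = cosh² t + s² e^{2t}`. -/
lemma normSq_mat_hyp_mul_unip (t s : ℝ) :
    Complex.normSq (mat (hyp t * unip s) 0 0) = Real.cosh t ^ 2 + s ^ 2 * Real.exp (2 * t) := by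
  have e : (Real.cosh t : ℂ) + (s : ℂ) * I * ((Real.cosh t : ℂ) + (Real.sinh t : ℂ)) =
      (Real.cosh t : ℂ) + ((s * (Real.cosh t + Real.sinh t) : ℝ) : ℂ) * I := by
    push_cast
    ring
  rw [mat_hyp_mul_unip_zero_zero, ← cosh_add_sinh_sq, e, Complex.normSq_add_mul_I]
  ring

/-- The parametrisation `(t, s) ↦ a_t n_s` is continuous. -/
theorem continuous_hyp_mul_unip : Continuous fun p : ℝ × ℝ => hyp p.1 * unip p.2 :=
  (continuous_hyp.comp continuous_fst).mul (continuous_unip.comp continuous_snd)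

/-- **The parametrisation `(t, s) ↦ a_t n_s` is proper**: on a compact `K ⊆ SU(1,1)`, `|a(g)| ≤ B`, so
`|t| ≤ cosh t ≤ B` and `s² ≤ B² e^{-2t} ≤ B² e^{2B}`. -/
theorem tendsto_borel_cocompact :
    Tendsto (fun p : ℝ × ℝ => hyp p.1 * unip p.2) (cocompact (ℝ × ℝ)) (cocompact SU11) := by
  rw [Filter.hasBasis_cocompact.tendsto_right_iff]
  intro K hK
  obtain ⟨B, hB⟩ := hK.bddAbove_image
    (continuous_norm.comp T5SU11HyperbolicSubgroup.continuous_mat_zero_zero).continuousOn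
  rw [Filter.eventually_iff, Filter.mem_cocompact]
  refine ⟨Icc (-B) B ×ˢ Icc (-(B * Real.exp B)) (B * Real.exp B),
    isCompact_Icc.prod isCompact_Icc, fun p hp hmem => ?_⟩
  have h1 : ‖mat (hyp p.1 * unip p.2) 0 0‖ ≤ B := hB ⟨_, hmem, rfl⟩
  have hB0 : 0 ≤ B := (norm_nonneg _).trans h1
  have h2 : Real.cosh p.1 ^ 2 + p.2 ^ 2 * Real.exp (2 * p.1) ≤ B ^ 2 := by
    rw [← normSq_mat_hyp_mul_unip, Complex.normSq_eq_norm_sq]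
    exact pow_le_pow_left₀ (norm_nonneg _) h1 2
  have hc : Real.cosh p.1 ≤ B := by
    have := Real.cosh_pos p.1
    nlinarith [sq_nonneg p.2, Real.exp_pos (2 * p.1)]
  have ht : |p.1| ≤ B := (abs_le_cosh p.1).trans hc
  have hs : |p.2| ≤ B * Real.exp B := by
    have he : Real.exp (-B) ≤ Real.exp p.1 := Real.exp_le_exp.2 (abs_le.1 ht).1
    have he2 : Real.exp (-B) ^ 2 ≤ Real.exp (2 * p.1) := by
      rw [← Real.exp_nat_mul]
      push_cast
      rw [show (2 : ℝ) * -B = 2 * -B by ring]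
      exact Real.exp_le_exp.2 (by linarith [(abs_le.1 ht).1])
    have h3 : p.2 ^ 2 * Real.exp (-B) ^ 2 ≤ B ^ 2 := by
      calc p.2 ^ 2 * Real.exp (-B) ^ 2 ≤ p.2 ^ 2 * Real.exp (2 * p.1) := by gcongr
        _ ≤ B ^ 2 := by nlinarith [sq_nonneg (Real.cosh p.1)]
    have h4 : (p.2 * Real.exp (-B)) ^ 2 ≤ B ^ 2 := by rw [mul_pow]; exact h3
    have h5 : |p.2 * Real.exp (-B)| ≤ B := by
      have := sq_le_sq.1 h4
      rwa [abs_of_nonneg hB0] at this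
    rw [abs_mul, abs_of_pos (Real.exp_pos _)] at h5
    have h6 : |p.2| ≤ B / Real.exp (-B) := (le_div_iff₀ (Real.exp_pos _)).2 h5
    rwa [Real.exp_neg, div_inv_eq_mul] at h6
  exact hp ⟨abs_le.1 ht, abs_le.1 hs⟩

/-- The parametrisation is a proper map. -/
theorem isProperMap_hyp_mul_unip : IsProperMap fun p : ℝ × ℝ => hyp p.1 * unip p.2 :=
  isProperMap_iff_tendsto_cocompact.2 ⟨continuous_hyp_mul_unip, tendsto_borel_cocompact⟩

/-- `B = range ((t, s) ↦ a_t n_s)` as a set. -/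
lemma coe_borelSubgroup :
    (borelSubgroup : Set SU11) = Set.range fun p : ℝ × ℝ => hyp p.1 * unip p.2 := by
  ext g
  constructor
  · rintro ⟨t, s, rfl⟩
    exact ⟨(t, s), rfl⟩
  · rintro ⟨⟨t, s⟩, rfl⟩
    exact ⟨t, s, rfl⟩

/-- **`B` is closed in `SU(1,1)`** (the range of a proper map). -/
theorem isClosed_borelSubgroup : IsClosed (borelSubgroup : Set SU11) := by
  rw [coe_borelSubgroup]
  exact isProperMap_hyp_mul_unip.isClosed_range

/-- **`B` is not compact**. -/
instance noncompactSpace_borelSubgroup : NoncompactSpace borelSubgroup := by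
  refine ⟨fun hc => ?_⟩
  have hK : IsCompact (Set.range fun p : ℝ × ℝ => hyp p.1 * unip p.2) := by
    have := hc.image continuous_subtype_val
    rwa [Set.image_univ, Subtype.range_coe, coe_borelSubgroup] at this
  obtain ⟨p, hp⟩ := (tendsto_borel_cocompact.eventually hK.compl_mem_cocompact).exists
  exact hp ⟨p, rfl⟩

/-- `B` is a closed non-compact subgroup (both facts in one statement). -/
theorem isClosed_and_noncompact_borelSubgroup :
    IsClosed (borelSubgroup : Set SU11) ∧ NoncompactSpace borelSubgroup :=
  ⟨isClosed_borelSubgroup, inferInstance⟩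

end Summit.Ventures.HodgeRepro2.T5SU11BorelSubgroup
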